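import Summits.QuantumAdvantage.AdviceFreeQNC0.RingKernel
import HarnessLib

/-!
# Cell qa-qnc0 — planner qa-qnc0-p2's 5/6 map `zSixth` and its failure fibre: coordinates and instances

Planner qa-qnc0-p2 (ROUND-1 §8, `HOME/qa-qnc0-p2/artefacts/RingFrameSketch.lean`) gives an explicit
AFFINE ring strategy `zSixth` valid on every pattern except exactly the fibre `FibreL11`
("`K(x)` is a line spanned by a vector with `v_0 = v_1 = 1`"), kernel-checked there for
`N = 6, 7, 8` (`SixthMapLaw`, conjectured for all `N ≥ 6`; `|FibreL11| = ⌊2^N/6⌋`). This file: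

* repeats `zSixth` and `FibreL11` verbatim over the tree's `RingHLF.InKernel` / `RingHLF.Rel`;
* `fibreL11_iff` — for ALL `n ≥ 3`: `FibreL11 x ↔ (#zeros odd) ∧ sigmaSum x = (if x 0 then 2 else 1)`
  (p2's `fibreL11_coords_eight`, now every `n`; from the structure theorem `RingKernel.kernel_odd` /
  `kernel_even_*`), answering the referee's ROUND-1 request (i) on the fibre-labelling convention
  uniformly in `N`;
* `sixthMap_nine`, `sixthMap_ten`, `sixthMap_eleven` — the `N = 9, 10, 11` instances of
  `SixthMapLaw` by `native_decide` (referee request (i): "one kernel-checked `N = 9` instance settles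
  it"), next to `N = 6, 7, 8`: the failure class of `zSixth` is `FibreL11` for every `6 ≤ N ≤ 11`,
  odd and even alike.

WHAT THIS IS NOT: `SixthMapLaw` for all `N` (the validity of `zSixth` off the fibre) is not proved
here.
-/

namespace Summit.QuantumAdvantage.AdviceFreeQNC0

open Finset Literature.Computability.QuantumComplexity Literature.Computability.QuantumComplexity.RingHLF

variable {N : ℕ}

/-! ### Planner qa-qnc0-p2's definitions (verbatim) -/

/-- The explicit affine map `Z_N` (planner qa-qnc0-p2). Even `N`: `z_0 = ⊕_{2≤i≤N-2} x_i`,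
`z_1 = ⊕_{3≤i≤N-1} x_i`, `z_2 = z_3 = 0`, `z_j = x_{j-1} ⊕ x_j` (`j ≥ 4` even), `z_j = x_{j-1}`
(`j ≥ 5` odd). Odd `N`: same `z_0, z_1`; `z_2 = x_2`, `z_3 = 0`, `z_j = x_{j-1}` (`4 ≤ j ≤ N-3`),
`z_{N-2} = 1 ⊕ x_{N-3}`, `z_{N-1} = 1 ⊕ x_{N-2} ⊕ x_{N-1}`. -/
def zSixth (x : Fin N → Bool) (j : Fin N) : Bool :=
  if j.val = 0 then decide ((univ.filter fun i : Fin N => 2 ≤ i.val ∧ i.val + 2 ≤ N ∧ x i = true).card % 2 = 1)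
  else if j.val = 1 then decide ((univ.filter fun i : Fin N => 3 ≤ i.val ∧ x i = true).card % 2 = 1)
  else if N % 2 = 0 then
    (if j.val < 4 then false
     else if j.val % 2 = 0 then xor (x ⟨j.val - 1, by omega⟩) (x j) else x ⟨j.val - 1, by omega⟩)
  else
    (if j.val = 2 then x j
     else if j.val = 3 then false
     else if j.val + 3 ≤ N then x ⟨j.val - 1, by omega⟩
     else if j.val + 2 = N then !(x ⟨j.val - 1, by omega⟩)
     else !(xor (x ⟨j.val - 1, by omega⟩) (x j)))

/-- The failure fibre (planner qa-qnc0-p2): `K(x)` is one-dimensional and spanned by a vector with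
`v_0 = v_1 = 1`. -/
def FibreL11 (x : Fin N → Bool) : Prop :=
  ∃ v : Fin N → Bool, InKernel x v ∧ (∀ i : Fin N, i.val = 0 ∨ i.val = 1 → v i = true) ∧
    ∀ w : Fin N → Bool, InKernel x w → (w = fun _ => false) ∨ w = v

/-- `FibreL11` is decidable (finite check). -/
instance (x : Fin N → Bool) : Decidable (FibreL11 x) := by
  unfold FibreL11; infer_instance

/-! ### The fibre in dictionary coordinates (all `n`) -/

/-- The first two coordinates of a trajectory: `v_0 = s.2`, `v_1 = s.1 ⊕ x_0 s.2`. -/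
theorem kernelVec_zero_one (hN : 3 ≤ N) (x : Fin N → Bool) (s : St) :
    kernelVec x s ⟨0, by omega⟩ = s.2 ∧ kernelVec x s ⟨1, by omega⟩ = xor s.1 (x ⟨0, by omega⟩ && s.2) := by
  constructor
  · simp [kernelVec]
  · show (iter x (0 + 1) s).2 = _
    rw [iter_succ x (by omega), iter_zero]
    rfl

/-- Distinct initial states give distinct trajectories when fixed (`v_0 = s.2`, `v_{n−1} = s.1`). -/
theorem kernelVec_injective_of_fixed (hN : 3 ≤ N) (x : Fin N → Bool) {s s' : St}
    (hs : monodromy (List.ofFn x) s = s) (hs' : monodromy (List.ofFn x) s' = s')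
    (h : kernelVec x s = kernelVec x s') : s = s' := by
  have h0 := congrFun h ⟨0, by omega⟩
  have hl := congrFun h ⟨N - 1, by omega⟩
  simp only [kernelVec, iter_zero] at h0
  have e1 := iter_succ_fst x (show N - 1 < N by omega) s
  have e2 := iter_succ_fst x (show N - 1 < N by omega) s'
  rw [show N - 1 + 1 = N by omega, iter_length] at e1 e2
  rw [hs] at e1
  rw [hs'] at e2
  simp only [kernelVec] at hl
  rw [← e1, ← e2] at hl
  exact Prod.ext hl h0

/-- **The fibre in coordinates, all `n ≥ 3`** (p2's `fibreL11_coords_eight` for every length):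
`FibreL11 x` iff the number of zeros of `x` is odd and `sigmaSum x = 2` if `x_0 = 1`, `= 1` if
`x_0 = 0`. -/
theorem fibreL11_iff (hN : 3 ≤ N) (x : Fin N → Bool) :
    FibreL11 x ↔ (reflBit (List.ofFn x) = true ∧
      sigmaSum (List.ofFn x) = (if x ⟨0, by omega⟩ then 2 else 1)) := by
  constructor
  · rintro ⟨v, hv, h01, huniq⟩
    have hv0 := h01 ⟨0, by omega⟩ (Or.inl rfl)
    have hv1 := h01 ⟨1, by omega⟩ (Or.inr rfl)
    -- the class must be odd: in the even class the kernel is `{0}` or has four elements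
    by_cases hrb : reflBit (List.ofFn x) = true
    · refine ⟨hrb, ?_⟩
      rcases (kernel_odd hN x hrb v).1 hv with h0 | hstar
      · rw [h0] at hv0; exact absurd hv0 (by simp)
      · set S := sigmaSum (List.ofFn x) with hS
        have h := kernelVec_zero_one hN x (fixVec S)
        rw [← hstar] at h
        rw [hv0] at h; rw [hv1] at h
        obtain ⟨ha, hb⟩ := h
        -- case analysis on `S` and `x_0`
        have hS3 : S = 0 ∨ S = 1 ∨ S = 2 := by
          have h3 : ∀ T : ZMod 3, T = 0 ∨ T = 1 ∨ T = 2 := by decide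
          exact h3 S
        rcases hS3 with h0 | h1 | h2
        · rw [h0] at ha; exact absurd ha.symm (by simp [fixVec])
        · rw [h1] at hb
          simp only [fixVec, one_ne_zero, if_false, if_true, Bool.and_true] at hb
          rw [h1]
          revert hb; cases x ⟨0, by omega⟩ <;> simp
        · rw [h2] at hb
          simp only [fixVec, show (2 : ZMod 3) ≠ 0 by decide, show (2 : ZMod 3) ≠ 1 by decide,
            if_false, Bool.and_true, Bool.false_xor] at hb
          rw [h2, ← hb]; simp
    · exfalso
      rw [Bool.not_eq_true] at hrb
      by_cases hS : sigmaSum (List.ofFn x) = 0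
      · -- dimension two: `kernelVec (0,1)` and `kernelVec (1,1)` are two distinct nonzero kernel vectors
        have hfix : ∀ s : St, monodromy (List.ofFn x) s = s := fun s => by
          rw [monodromy_eq_dict, hrb, dict_false_fixed_iff]; exact Or.inl hS
        have hk : ∀ s : St, InKernel x (kernelVec x s) := fun s =>
          (kernel_even_full hN x hrb hS _).2 ⟨s, rfl⟩
        have hne : ∀ s : St, s ≠ (false, false) → kernelVec x s ≠ fun _ => false :=
          fun s hs => kernelVec_ne_zero hN x (hfix s) hs
        rcases huniq _ (hk (false, true)) with h | h
        · exact hne _ (by decide) h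
        · rcases huniq _ (hk (true, true)) with h' | h'
          · exact hne _ (by decide) h'
          · have := kernelVec_injective_of_fixed hN x (hfix _) (hfix _) (h.trans h'.symm)
            exact absurd this (by decide)
      · -- dimension zero
        have := (kernel_even_trivial hN x hrb hS v).1 hv
        rw [this] at hv0; exact absurd hv0 (by simp)
  · rintro ⟨hrb, hS⟩
    set S := sigmaSum (List.ofFn x)
    refine ⟨kernelVec x (fixVec S), (kernel_odd hN x hrb _).2 (Or.inr rfl), ?_, ?_⟩
    · have h := kernelVec_zero_one hN x (fixVec S)
      intro i hi
      rcases hi with hi | hi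
      · have : i = ⟨0, by omega⟩ := Fin.ext hi
        rw [this, h.1, hS]
        cases x ⟨0, by omega⟩ <;> decide
      · have : i = ⟨1, by omega⟩ := Fin.ext hi
        rw [this, h.2, hS]
        cases x ⟨0, by omega⟩ <;> decide
    · intro w hw
      exact (kernel_odd hN x hrb w).1 hw

/-! ### Kernel-checked instances of `SixthMapLaw` -/

/-- `SixthMapLaw` at `N = 6` (p2's `sixthMap_six`, over the tree's `RingHLF.Rel`). -/
theorem sixthMap_six : ∀ x : Fin 6 → Bool, Rel x (zSixth x) ↔ ¬ FibreL11 x := by native_decide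

/-- `SixthMapLaw` at `N = 7`. -/
theorem sixthMap_seven : ∀ x : Fin 7 → Bool, Rel x (zSixth x) ↔ ¬ FibreL11 x := by native_decide

/-- `SixthMapLaw` at `N = 8`. -/
theorem sixthMap_eight : ∀ x : Fin 8 → Bool, Rel x (zSixth x) ↔ ¬ FibreL11 x := by native_decide

/-- `SixthMapLaw` at `N = 9` (referee ROUND-1 request (i)). -/
theorem sixthMap_nine : ∀ x : Fin 9 → Bool, Rel x (zSixth x) ↔ ¬ FibreL11 x := by native_decide

/-- `SixthMapLaw` at `N = 10`. -/
theorem sixthMap_ten : ∀ x : Fin 10 → Bool, Rel x (zSixth x) ↔ ¬ FibreL11 x := by native_decide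

/-- `SixthMapLaw` at `N = 11`. -/
theorem sixthMap_eleven : ∀ x : Fin 11 → Bool, Rel x (zSixth x) ↔ ¬ FibreL11 x := by native_decide

end Summit.QuantumAdvantage.AdviceFreeQNC0
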